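import Mathlib
import Summits.PneNP.PneNP.Theorems.NegLimitedLadderFixedK
import Summits.PneNP.PneNP.Theorems.NegLimitedSparseLadderRelativePow
import Summits.PneNP.PneNP.Theorems.NegLimitedSparseLadderAdvantage
import HarnessLib

/-!
# Route NegLimited — line `sparse-ladder`, stub `stub_sparseTradeoffAssembly` (rung F-N1/p3, ROUND-10)

Registered stub of the skeleton `sparse-ladder` on the rung item
`NegLimited.NeglimitedInverseLinearNegations` (stmt-PneNP-19681; HOME/pnp-ideate-p3/r10/sparse-ladder.lean,
sha dee521b8906a2977): the ASSEMBLY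

  `SparseRelativePow → SparseLadderAdvantage → NeglimitedCliqueSparseTradeoff`

and, both supports being landed (`NegLimitedSparseLadderRelativePow.lean`,
`NegLimitedSparseLadderAdvantage.lean`), the engine-level theorem **R10-A**
`neglimitedCliqueSparseTradeoff_holds : NeglimitedCliqueSparseTradeoff` outright: for every `c`,
eventually in `n`, a De Morgan circuit computing `CLIQUE(n, 8c+17)` with at most `⌊log₂ n⌋/(8c+18)` NOT
gates has at least `n^c` gates (an inverse-linear negations/size-exponent trade-off).

The proof is the ROUND-9 density ladder (`NegLimitedLadder.stub_fixedKAssembly`,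
Theorems/NegLimitedLadderFixedK.lean) run with Rossman's SPARSE dose.  Parameters (given `c`):
`K = 4c+8`, clique size `k = 2K+1 = 8c+17`, class parameter `k' = K`, sprinkle exponent `ρ = 3/(2K)`,
closedness `δ = 1/(2K)`, window `a = 1/(2K) = 1/(8c+16)`, accuracy `a₀ = 1/2`, budget exponent
`b = 1/(8c+18)`; `q = n^{-ρ}`, `T = ⌊n^a⌋₊`, rungs `p_j = 1 - (1-q)^j` (`j ≤ T`).

* `ρ + δ = 2/K = 2/k'`, `4(c+2) = K ≤ k`: `SparseRelativePow` applies to every monotone member `M` of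
  size `≤ n^c`, giving the pointwise relative bound with `E = n^{-1/2} + e^{-n^{δ/2}}`; then
  `SparseLadderAdvantage`: `Σ_{j ≤ T} plantFlipProb(p_j, M) ≤ (T+1) E + 1`.
* `p_j ≤ T q ≤ n^{a-ρ} = n^{-1/K} = n^{-2/(k-1)}` (Bernoulli, `ladder_density_bounds`): every rung is
  `K_k`-subcritical, `C(n,k) p_j^{C(k,2)} ≤ 1/4` (`firstMoment_le_quarter`), so `CLIQUE(n,k)` flips with
  probability `≥ 1/2` on every rung (`stub_subcriticalNullMass`, `plantFlipProb_cliqueFn`).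
* A De Morgan circuit `D` of size `< n^c` with `t ≤ ⌊log₂ n⌋/(8c+18)` NOT gates computing `CLIQUE(n,k)`
  is covered by `≤ 2^{t+1} - 1 < 2 n^b` constant-or-monotone members of size `≤ n^c`
  (`NegLimitedDoor.stub_amCoverMonPairs`), and planted flips of `CLIQUE` are flips of some member
  (`NegLimitedDoor.stub_flipProbLeSum`).
* Summing over the rungs: `(T+1)/2 ≤ 2 n^b ((T+1)(2 n^{-1/2}) + (T+1) n^{-a})`
  (`e^{-n^{δ/2}} ≤ n^{-1/2}`, `1 ≤ (T+1) n^{-a}`), i.e. `1/2 ≤ 4 n^{-(1/2-b)} + 2 n^{-(a-b)}` — false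
  eventually since `b < a < 1/2`.

References: B. Rossman, *The monotone complexity of k-clique on random graphs*, FOCS 2010 /
SIAM J. Comput. 43 (2014), Thm 1 (p. 4), §6–§7 [Rossman2010]; K. Amano, A. Maruoka, SIAM J. Comput.
35 (2005) [AmanoMaruoka2005] (the cover); cell record HOME/pnp-ideate-p3/r10/sparse-ladder.md §Stubs 3.
-/

set_option linter.dupNamespace false -- `Summit.PneNP.PneNP.…`: summit = sub-problem name (D-0017 single-conjunct layout)

noncomputable section

namespace Summit.PneNP.PneNP.Theorems.NegLimitedSparseLadder

open Finset Filter
open Literature.Computability.Complexity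
open Summit.PneNP.PneNP.Theorems.NegLimitedDoor
open Summit.PneNP.PneNP.Theorems.NegLimitedLadder


/-! ### The stub statement (verbatim from the registered skeleton `sparse-ladder`) -/

/-- stub 3 target / engine-level theorem **R10-A** `NeglimitedCliqueSparseTradeoff` (verbatim from
HOME/pnp-ideate-p3/r10/sparse-ladder.lean): for every `c`, eventually in `n`, a De Morgan circuit computing
`CLIQUE(n, 8c+17)` with at most `⌊log₂ n⌋/(8c+18)` NOT gates has at least `n^c` gates. -/
def NeglimitedCliqueSparseTradeoff : Prop :=
  ∀ c : ℕ, ∀ᶠ n : ℕ in atTop,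
    ∀ D : Circuit ↥(⊤ : SimpleGraph (Fin n)).edgeSet,
      D.IsOver deMorganBasis → D.Computes (cliqueFn n (8 * c + 17)) →
      D.negationCount ≤ Nat.log 2 n / (8 * c + 18) → n ^ c ≤ D.size

/-! ### Parameter arithmetic -/

/-- NOT budget: `t ≤ ⌊log₂ n⌋ / B` gives `2^t ≤ n^{1/B}` (`n ≥ 1`, `B ≥ 1`). -/
theorem two_pow_le_rpow_of_budget_div {n B t : ℕ} (hn : 1 ≤ n) (hB : 1 ≤ B)
    (ht : t ≤ Nat.log 2 n / B) : (2 : ℝ) ^ t ≤ (n : ℝ) ^ (1 / (B : ℝ)) := by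
  -- adapted from `NegLimitedLadder.two_pow_le_rpow_of_budget` (`B = k⁴` there)
  have hB0 : 0 < B := hB
  have h1 : B * t ≤ Nat.log 2 n := by
    have := (Nat.le_div_iff_mul_le hB0).1 ht
    linarith [Nat.mul_comm t B]
  have h2 : 2 ^ (B * t) ≤ n :=
    (Nat.pow_le_pow_right (by norm_num) h1).trans (Nat.pow_log_le_self 2 (by omega))
  have h3 : ((2 : ℝ) ^ t) ^ B ≤ (n : ℝ) := by
    rw [← pow_mul, mul_comm]
    exact_mod_cast h2
  have h4 : (0 : ℝ) ≤ (2 : ℝ) ^ t := by positivity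
  have hB' : B ≠ 0 := hB0.ne'
  calc (2 : ℝ) ^ t = (((2 : ℝ) ^ t) ^ B) ^ ((B : ℝ)⁻¹) := (Real.pow_rpow_inv_natCast h4 hB').symm
    _ ≤ (n : ℝ) ^ ((B : ℝ)⁻¹) := Real.rpow_le_rpow (by positivity) h3 (by positivity)
    _ = (n : ℝ) ^ (1 / (B : ℝ)) := by rw [one_div]

/-- The window beats the budget and sits below the accuracy: with `K = 4c+8`,
`1/(8c+18) < 1/(2K) < 1/2`, and the exponent identity `1/(2K) - 3/(2K) = -(2/(k-1))` for `k = 2K+1`. -/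
theorem sparse_params (c : ℕ) :
    (1 : ℝ) / ((8 * c + 18 : ℕ) : ℝ) < 1 / (2 * ((4 * c + 8 : ℕ) : ℝ)) ∧
    (1 : ℝ) / (2 * ((4 * c + 8 : ℕ) : ℝ)) < 1 / 2 ∧
    (1 : ℝ) / (2 * ((4 * c + 8 : ℕ) : ℝ)) + -(3 / (2 * ((4 * c + 8 : ℕ) : ℝ))) =
      -(2 / (((2 * (4 * c + 8) + 1 : ℕ) : ℝ) - 1)) ∧
    (3 : ℝ) / (2 * ((4 * c + 8 : ℕ) : ℝ)) + 1 / (2 * ((4 * c + 8 : ℕ) : ℝ)) =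
      2 / ((4 * c + 8 : ℕ) : ℝ) := by
  have hc : (0 : ℝ) ≤ c := Nat.cast_nonneg c
  refine ⟨?_, ?_, ?_, ?_⟩
  · rw [div_lt_div_iff₀ (by positivity) (by positivity)]
    push_cast
    nlinarith
  · rw [div_lt_div_iff₀ (by positivity) (by norm_num)]
    push_cast
    nlinarith
  · push_cast
    field_simp
    ring
  · push_cast
    field_simp
    ring

/-! ### The stub -/

/-- **Stub `stub_sparseTradeoffAssembly` of line `sparse-ladder` PROVED** (by name):
`SparseRelativePow → SparseLadderAdvantage → NeglimitedCliqueSparseTradeoff` — the density ladder of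
`NegLimitedLadder.stub_fixedKAssembly` at the sparse dose (module docstring). -/
theorem stub_sparseTradeoffAssembly :
    SparseRelativePow → SparseLadderAdvantage → NeglimitedCliqueSparseTradeoff := by
  intro hRP hLA c
  classical
  -- parameters
  set K : ℕ := 4 * c + 8 with hK
  set k : ℕ := 2 * (4 * c + 8) + 1 with hk
  have hk17 : k = 8 * c + 17 := by rw [hk]; ring
  have hK5 : 5 ≤ K := by omega
  have hKk : K ≤ k := by omega
  have hk5 : 5 ≤ k := by omega
  have hKR : (0 : ℝ) < (K : ℝ) := by positivity
  set ρ : ℝ := 3 / (2 * (K : ℝ)) with hρ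
  set δ : ℝ := 1 / (2 * (K : ℝ)) with hδ
  set a : ℝ := 1 / (2 * (K : ℝ)) with ha
  set b : ℝ := 1 / ((8 * c + 18 : ℕ) : ℝ) with hb
  have hρ0 : 0 < ρ := by positivity
  have hδ0 : 0 < δ := by positivity
  have ha0 : 0 < a := by positivity
  obtain ⟨hba, ha2, hexp_id, hρδ_id⟩ := sparse_params c
  have hρδ : ρ + δ ≤ 2 / (K : ℝ) := le_of_eq hρδ_id
  -- eventual conditions in `n`
  have e1 := hRP c k K ρ δ (1 / 2) hK5 (le_of_eq hK.symm) hKk hρ0 hδ0 hρδ (by norm_num)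
    (by norm_num)
  have e2 := eventually_exp_le_rpow_neg (a := 1 / 2) (c := δ / 2) (by positivity)
  have e3 := eventually_mul_rpow_neg_lt (c := a - b) (by linarith) (by norm_num : (0 : ℝ) < 1 / 4) 2
  have e4 := eventually_mul_rpow_neg_lt (c := 1 / 2 - b) (by linarith)
    (by norm_num : (0 : ℝ) < 1 / 4) 4
  filter_upwards [e1, e2, e3, e4, eventually_ge_atTop k] with n hRel hexp hsmall3 hsmall4 hkn
  intro D hD hcomp hneg
  rw [← hk17] at hcomp
  by_contra hcon
  rw [not_le] at hcon
  -- notation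
  set t : ℕ := Nat.log 2 n / (8 * c + 18) with ht
  set q : ℝ := (n : ℝ) ^ (-ρ) with hq
  set η : ℝ := (n : ℝ) ^ (-(1 / 2 : ℝ)) with hη
  set ε : ℝ := Real.exp (-((n : ℝ) ^ (δ / 2))) with hε
  set E : ℝ := η + ε with hE
  set T : ℕ := ⌊(n : ℝ) ^ a⌋₊ with hT
  set p : ℕ → ℝ := fun j => 1 - (1 - q) ^ j with hp
  have hn1 : 1 ≤ n := by omega
  have hn0 : (0 : ℝ) < n := by exact_mod_cast hn1
  have hn1R : (1 : ℝ) ≤ n := by exact_mod_cast hn1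
  have hη0 : 0 < η := Real.rpow_pos_of_pos hn0 _
  have hε0 : 0 < ε := Real.exp_pos _
  have hE0 : 0 < E := by positivity
  have hq0 : 0 ≤ q := Real.rpow_nonneg hn0.le _
  have hq1 : q ≤ 1 := Real.rpow_le_one_of_one_le_of_nonpos hn1R (by linarith)
  have hna0 : 0 ≤ (n : ℝ) ^ a := Real.rpow_nonneg hn0.le _
  have hTle : (T : ℝ) ≤ (n : ℝ) ^ a := Nat.floor_le hna0
  have hTlt : (n : ℝ) ^ a < (T : ℝ) + 1 := Nat.lt_floor_add_one _
  -- the top rung is the threshold density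
  have htop : (T : ℝ) * q ≤ (n : ℝ) ^ (-(2 / ((k : ℝ) - 1))) := by
    calc (T : ℝ) * q ≤ (n : ℝ) ^ a * q := mul_le_mul_of_nonneg_right hTle hq0
      _ = (n : ℝ) ^ (-(2 / ((k : ℝ) - 1))) := by
          rw [hq, ← Real.rpow_add hn0, ha, hρ, hexp_id, hk]
  have hqb : ∀ j, j ≤ T → 0 ≤ p j ∧ p j ≤ (n : ℝ) ^ (-(2 / ((k : ℝ) - 1))) ∧ p j ≤ 1 := by
    intro j hj
    obtain ⟨h0, hTp, h1⟩ := ladder_density_bounds hq0 hq1 hj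
    exact ⟨h0, hTp.trans htop, h1⟩
  -- the Amano–Maruoka / Rossman cover of `D`
  obtain ⟨gs, hlen, hmem, hcov⟩ := stub_amCoverMonPairs _ D t hD hneg
  -- planted flips of CLIQUE are jumps of `D`, hence of a member
  have hcover : ∀ A ∈ powersetCard k (univ : Finset (Fin n)), ∀ x,
      cliqueFn n k x ≠ cliqueFn n k (plantClique A x) →
        ∃ g ∈ gs, g x ≠ g (plantClique A x) := by
    intro A hA x hx
    have hAk : #A = k := (mem_powersetCard.1 hA).2
    have htrue : cliqueFn n k (plantClique A x) = true := cliqueFn_plantClique (by omega) x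
    have hfalse : cliqueFn n k x = false := by
      cases h : cliqueFn n k x
      · rfl
      · rw [h, htrue] at hx
        exact absurd rfl hx
    obtain ⟨g, hg, hgx, hgy⟩ := hcov x (plantClique A x) (le_plantClique A x)
      (by rw [hcomp x, hfalse]) (by rw [hcomp, htrue])
    exact ⟨g, hg, by rw [hgx, hgy]; decide⟩
  -- (1) lower bound at each rung: the clique-free mass is at least `1/2`
  have hlow : ∀ j ∈ range (T + 1), (1 / 2 : ℝ) ≤ plantFlipProb n k (p j) (cliqueFn n k) := by
    intro j hj
    have hjT : j ≤ T := by have := mem_range.1 hj; omega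
    obtain ⟨hp0, hpt, hp1⟩ := hqb j hjT
    have hfm := firstMoment_le_quarter hk5 hn1 hp0 hpt
    have h := stub_subcriticalNullMass n k (p j) (1 / 4) hkn hp0 hp1 hfm (by norm_num)
    rw [plantFlipProb_cliqueFn hkn]
    have e : (1 : ℝ) - 2 * (1 / 4) = 1 / 2 := by norm_num
    rw [e] at h
    exact h
  -- (2) upper bound per member
  set B : ℝ := ((T : ℝ) + 1) * E + 1 with hB
  have hB0 : 0 ≤ B := by positivity
  have hup : ∀ g ∈ gs, ∑ j ∈ range (T + 1), plantFlipProb n k (p j) g ≤ B := by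
    intro g hg
    rcases hmem g hg with ⟨bb, hbb⟩ | ⟨M, hM, hMsize, hMg⟩
    · rw [sum_eq_zero fun j _ => plantFlipProb_of_const (p j) hbb]
      exact hB0
    · have hM01 : M.IsOver monotoneBasis01 := hM.mono monotoneBasis_subset_monotoneBasis01
      have hMsz : M.size ≤ n ^ c := by omega
      have hmono : Monotone M.eval := M.monotone_eval_of_isOver_monotoneBasis01 hM01
      have hpt := hRel M hM01 hMsz
      have h := hLA n k hkn q E hq0 hq1 M.eval hmono hpt T
      calc ∑ j ∈ range (T + 1), plantFlipProb n k (p j) g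
          = ∑ j ∈ range (T + 1), plantFlipProb n k (1 - (1 - q) ^ j) M.eval :=
            sum_congr rfl fun j _ => by rw [plantFlipProb_congr hMg]
        _ ≤ B := h
  -- (3) the union bound, summed over the rungs
  have hchain : ((T : ℝ) + 1) * (1 / 2) ≤ (gs.length : ℝ) * B := by
    calc ((T : ℝ) + 1) * (1 / 2) = ∑ j ∈ range (T + 1), (1 / 2 : ℝ) := by
          rw [sum_const, card_range, nsmul_eq_mul]
          push_cast
          ring
      _ ≤ ∑ j ∈ range (T + 1), plantFlipProb n k (p j) (cliqueFn n k) := sum_le_sum hlow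
      _ ≤ ∑ j ∈ range (T + 1), (gs.map (plantFlipProb n k (p j))).sum :=
          sum_le_sum fun j hj => by
            have hjT : j ≤ T := by have := mem_range.1 hj; omega
            obtain ⟨hp0, -, hp1⟩ := hqb j hjT
            exact stub_flipProbLeSum n k (p j) hp0 hp1 _ gs hcover
      _ = (gs.map fun g => ∑ j ∈ range (T + 1), plantFlipProb n k (p j) g).sum :=
          (list_sum_map_finset_sum gs _ _).symm
      _ ≤ (gs.length : ℝ) * B := sum_map_le_length_mul gs _ B hup
  -- (4) numerics
  have hlenR : (gs.length : ℝ) ≤ 2 * (n : ℝ) ^ b := by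
    have h2t : (2 : ℝ) ^ t ≤ (n : ℝ) ^ b := by
      rw [hb]
      exact two_pow_le_rpow_of_budget_div hn1 (by omega) le_rfl
    have h1 : 1 ≤ 2 ^ (t + 1) := Nat.one_le_two_pow
    have h2 : gs.length + 1 ≤ 2 ^ (t + 1) := by omega
    have h3 : ((gs.length + 1 : ℕ) : ℝ) ≤ ((2 ^ (t + 1) : ℕ) : ℝ) := by exact_mod_cast h2
    push_cast at h3
    rw [pow_succ] at h3
    linarith
  have hBle : B ≤ ((T : ℝ) + 1) * (2 * η + (n : ℝ) ^ (-a)) := by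
    have h1 : 1 ≤ ((T : ℝ) + 1) * (n : ℝ) ^ (-a) := by
      have hid : (n : ℝ) ^ a * (n : ℝ) ^ (-a) = 1 := by
        rw [← Real.rpow_add hn0, add_neg_cancel, Real.rpow_zero]
      have hna' : 0 ≤ (n : ℝ) ^ (-a) := Real.rpow_nonneg hn0.le _
      nlinarith
    have h2 : ε ≤ η := hexp
    have hT0 : (0 : ℝ) ≤ (T : ℝ) + 1 := by positivity
    have h3 : E ≤ 2 * η := by rw [hE]; linarith
    nlinarith
  have hfin : (1 / 2 : ℝ) ≤ 4 * (n : ℝ) ^ (-(1 / 2 - b)) + 2 * (n : ℝ) ^ (-(a - b)) := by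
    have hT0 : (0 : ℝ) < (T : ℝ) + 1 := by positivity
    have hnb : 0 ≤ (n : ℝ) ^ b := Real.rpow_nonneg hn0.le _
    have h := calc ((T : ℝ) + 1) * (1 / 2) ≤ (gs.length : ℝ) * B := hchain
      _ ≤ (2 * (n : ℝ) ^ b) * (((T : ℝ) + 1) * (2 * η + (n : ℝ) ^ (-a))) :=
          mul_le_mul hlenR hBle hB0 (by positivity)
      _ = ((T : ℝ) + 1) * (4 * ((n : ℝ) ^ b * η) + 2 * ((n : ℝ) ^ b * (n : ℝ) ^ (-a))) := by ring
    have h2 := le_of_mul_le_mul_left h hT0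
    rw [hη, ← Real.rpow_add hn0, ← Real.rpow_add hn0] at h2
    have he1 : b + -(1 / 2 : ℝ) = -(1 / 2 - b) := by ring
    have he2 : b + -a = -(a - b) := by ring
    rw [he1, he2] at h2
    exact h2
  linarith

/-- **R10-A `NeglimitedCliqueSparseTradeoff` PROVED outright**: for every `c`, eventually in `n`, every
De Morgan circuit computing `CLIQUE(n, 8c+17)` with at most `⌊log₂ n⌋/(8c+18)` NOT gates has at least
`n^c` gates — the assembly applied to the two landed stubs `stub_sparseRelativePow`,
`stub_sparseLadderAdvantage`. -/
theorem neglimitedCliqueSparseTradeoff_holds : NeglimitedCliqueSparseTradeoff :=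
  stub_sparseTradeoffAssembly stub_sparseRelativePow stub_sparseLadderAdvantage

end Summit.PneNP.PneNP.Theorems.NegLimitedSparseLadder
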